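import Mathlib
import HarnessLib
import Summits.AtomisticToContinuum.FouriersLaw.Theses.JunctionLocality
import Literature.MathematicalPhysics.KineticTheory.LangevinChainGibbs
import Summits.AtomisticToContinuum.FouriersLaw.Theorems.JunctionLocalityInsertionCore
import Summits.AtomisticToContinuum.FouriersLaw.Theorems.JunctionLocalitySuperadditiveResistanceThermoIBP

/-!
# Stub `stub_insertionIdentity` of line `thermalise-then-cut-probe-insertion` (crux stmt-AtomisticToContinuum-11748)

The vocabulary block below is copied VERBATIM from the registered skeleton (except that `thermo` and
`junctionOU`, already declared verbatim in this namespace by `…ThermoIBP.lean`, are imported from there: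
one fully-qualified name, one module)
`Cruxes/SuperadditiveResistance/Lines/thermalise-then-cut-probe-insertion.lean` (same namespace,
same names), so the theorem has literally the registered signature. Its proof unfolds the frames
into `InsertionToolbox.Assembly.insertion_core` (support files
`JunctionLocalityInsertion{Calculus,Cutoff,IBP,GibbsProduct,Mollify,Energy,RemoveCutoff,Orthogonality,WeakPairing,Package,Core}.lean`),
which proves the identity from the frames AS TYPED: the missing regularity of the forward fields
(`∂_p gb ∈ L²(μ_T)`) is the energy estimate, the `C^∞_c → C²_c` passage of the weak equation is a
mollification, `S_K ⟂ range Π_K` is the product structure of `μ_T`, and the floating source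
`W₂ + W₃ = −γ S_K e_K`, the current conservation and the sum rule are identities of the frames.
-/

noncomputable section

open MeasureTheory Filter Topology ProbabilityTheory
open scoped ContDiff NNReal
open Literature.MathematicalPhysics.KineticTheory.HeatConduction
open Summit.AtomisticToContinuum.FouriersLaw.Cruxes.SuperadditiveResistance

namespace Summit.AtomisticToContinuum.FouriersLaw.Cruxes.SuperadditiveResistance.ThermaliseThenCutProbeInsertion

/-! ## Device vocabulary (local definitions over the tree's `OscillatorChain` API) -/

/-- `p_s²` of site `s` (as a `Fin`-proof-free sum; `0` if `s ≥ L`). -/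
def kin (L s : ℕ) (x : PhaseSpace L) : ℝ :=
  ∑ i : Fin L, if i.val = s then x.2 i ^ 2 else 0

-- `thermo` (OU thermostat `θ ∂²_{p_s} − p_s ∂_{p_s}` on `p_s`): this definition of the skeleton is
-- declared, verbatim and in this namespace, by the imported
-- `Theorems/JunctionLocalitySuperadditiveResistanceThermoIBP.lean` (p74678); the gate allows one
-- module per fully-qualified name, so it is imported rather than restated here.

/-- Terminal sites of the device for the split `(N, M)`: terminals `0,1,2,3` (= baths 1,2,3,4 of
the card) sit on sites `0, N−1, N, N+M−1`. -/
def termSite (N M : ℕ) : Fin 4 → ℕ := ![0, N - 1, N, N + M - 1]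

variable (P : OscillatorChain)

/-- Generator of the DEVICE: the `(N+M)`-chain `P` between its end baths (temperatures `τ 0`,
`τ 3`) with two additional Langevin thermostats of the chain's own strength `P.γ` on the junction
momenta `p_{N−1}` (temperature `τ 1`) and `p_N` (temperature `τ 2`); the junction bond is kept. -/
def deviceGenerator (N M : ℕ) (τ : Fin 4 → ℝ) (f : PhaseSpace (N + M) → ℝ)
    (x : PhaseSpace (N + M)) : ℝ :=
  P.generator (N + M) (τ 0) (τ 3) f x +
    P.γ * (thermo (N + M) (N - 1) (τ 1) f x + thermo (N + M) N (τ 2) f x)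

/-- Weak steady states of the device (same weak Fokker–Planck class as
`OscillatorChain.IsSteadyState`, with finite kinetic temperatures so that the four bath powers
`γ(τ_a − ⟨p_a²⟩)` are expectations). -/
def IsDeviceSteadyState (N M : ℕ) (τ : Fin 4 → ℝ) (μ : Measure (PhaseSpace (N + M))) : Prop :=
  IsProbabilityMeasure μ ∧
    (∀ f : PhaseSpace (N + M) → ℝ, ContDiff ℝ ∞ f → HasCompactSupport f →
      ∫ x, deviceGenerator P N M τ f x ∂μ = 0) ∧
    ∀ s : ℕ, Integrable (kin (N + M) s) μ

/-! ## Four-terminal Onsager algebra (pure real; `g a b`, `a ≠ b`, the transfer conductances) -/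

section OnsagerAlgebra

/-- Entropy-production quadratic form `Σ_a Σ_b g_ab (θ_a − θ_b)²` of the linearised powers
`J_a = Σ_b g_ab (θ_a − θ_b)`. -/
def dirichletForm (g : Fin 4 → Fin 4 → ℝ) (θ : Fin 4 → ℝ) : ℝ :=
  ∑ a, ∑ b, g a b * (θ a - θ b) ^ 2

/-- `u`: transfer conductance junction pair → bath 1 (terminal 0). -/
def transferLeft (g : Fin 4 → Fin 4 → ℝ) : ℝ := g 0 1 + g 0 2
/-- `v`: transfer conductance junction pair → bath 4 (terminal 3). -/
def transferRight (g : Fin 4 → Fin 4 → ℝ) : ℝ := g 1 3 + g 2 3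
/-- `x`: bypass (direct bath 4 → bath 1 transfer past the thermostatted pair). -/
def bypass (g : Fin 4 → Fin 4 → ℝ) : ℝ := g 0 3
/-- `a = L₁₁`: self-conductance of bath 1 in the device. -/
def selfLeft (g : Fin 4 → Fin 4 → ℝ) : ℝ := g 0 1 + g 0 2 + g 0 3
/-- `b = L₄₄`: self-conductance of bath 4 in the device. -/
def selfRight (g : Fin 4 → Fin 4 → ℝ) : ℝ := g 0 3 + g 1 3 + g 2 3
/-- `θᶠ`: first-order floating temperature of the merged probe pair (zero net uptake). -/
def floatTemp (g : Fin 4 → Fin 4 → ℝ) : ℝ :=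
  (transferLeft g - transferRight g) / (2 * (transferLeft g + transferRight g))
/-- `𝒢₁(θ)`: flux OUT of bath 1 per unit total bias when both probes sit at first-order
temperature `θ` (bias `+1/2` on bath 1, `−1/2` on bath 4). -/
def sideOne (g : Fin 4 → Fin 4 → ℝ) (θ : ℝ) : ℝ := bypass g + transferLeft g * (1 / 2 - θ)
/-- `𝒢₄(θ)`: flux INTO bath 4 per unit total bias in the same configuration. -/
def sideFour (g : Fin 4 → Fin 4 → ℝ) (θ : ℝ) : ℝ := bypass g + transferRight g * (1 / 2 + θ)
/-- `G_dev = 𝒢₁(θᶠ)`: two-terminal conductance of the device with the probe pair floating. -/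
def deviceConductance (g : Fin 4 → Fin 4 → ℝ) : ℝ := sideOne g (floatTemp g)

variable {g : Fin 4 → Fin 4 → ℝ}

/-- (Skeleton vocabulary, docstring added for the Theorems lint.) The Dirichlet form of symmetric
Onsager data, expanded as a sum of conductance-weighted squared differences. -/
theorem dirichletForm_eq (hsym : ∀ a b, g a b = g b a) (θ : Fin 4 → ℝ) :
    dirichletForm g θ = 2 * (g 0 1 * (θ 0 - θ 1) ^ 2 + g 0 2 * (θ 0 - θ 2) ^ 2 +
      g 0 3 * (θ 0 - θ 3) ^ 2 + g 1 2 * (θ 1 - θ 2) ^ 2 + g 1 3 * (θ 1 - θ 3) ^ 2 +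
      g 2 3 * (θ 2 - θ 3) ^ 2) := by
  simp only [dirichletForm, Fin.sum_univ_four]
  rw [hsym 1 0, hsym 2 0, hsym 3 0, hsym 2 1, hsym 3 1, hsym 3 2]
  ring

/-- (Skeleton vocabulary, docstring added for the Theorems lint.) Positivity of the Dirichlet form
gives `0 ≤ selfLeft g`. -/
theorem selfLeft_nonneg (hsym : ∀ a b, g a b = g b a) (hpsd : ∀ θ, 0 ≤ dirichletForm g θ) :
    0 ≤ selfLeft g := by
  have h := hpsd ![1, 0, 0, 0]
  rw [dirichletForm_eq hsym] at h
  simp at h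
  unfold selfLeft
  linarith

/-- (Skeleton vocabulary, docstring added for the Theorems lint.) Positivity of the Dirichlet form
gives `0 ≤ selfRight g`. -/
theorem selfRight_nonneg (hsym : ∀ a b, g a b = g b a) (hpsd : ∀ θ, 0 ≤ dirichletForm g θ) :
    0 ≤ selfRight g := by
  have h := hpsd ![0, 0, 0, 1]
  rw [dirichletForm_eq hsym] at h
  simp at h
  unfold selfRight
  linarith

/-- (Skeleton vocabulary, docstring added for the Theorems lint.) Positivity of the Dirichlet form
gives `0 ≤ transferLeft g + transferRight g`. -/
theorem transfer_sum_nonneg (hsym : ∀ a b, g a b = g b a) (hpsd : ∀ θ, 0 ≤ dirichletForm g θ) :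
    0 ≤ transferLeft g + transferRight g := by
  have h := hpsd ![0, 1, 1, 0]
  rw [dirichletForm_eq hsym] at h
  simp at h
  unfold transferLeft transferRight
  linarith

/-- In a PSD form a vanishing diagonal entry kills its row: `u + v = 0 ⇒ u = 0`. -/
theorem transferLeft_eq_zero (hsym : ∀ a b, g a b = g b a) (hpsd : ∀ θ, 0 ≤ dirichletForm g θ)
    (h0 : transferLeft g + transferRight g = 0) : transferLeft g = 0 := by
  by_contra hu
  have key : ∀ t : ℝ, 0 ≤ transferLeft g - 2 * transferLeft g * t + bypass g := by
    intro t
    have h := hpsd ![1, t, t, 0]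
    rw [dirichletForm_eq hsym] at h
    simp at h
    have hv : g 1 3 + g 2 3 = -(g 0 1 + g 0 2) := by
      unfold transferLeft transferRight at h0; linarith
    unfold transferLeft bypass
    nlinarith [hv]
  have h1 := key ((transferLeft g + bypass g + 1) / (2 * transferLeft g))
  have h2 : 2 * transferLeft g * ((transferLeft g + bypass g + 1) / (2 * transferLeft g)) =
      transferLeft g + bypass g + 1 := by
    field_simp
  linarith

/-- DIRICHLET PRINCIPLE for the floating node (from the second law only): the floating device
conductance is below the entropy production of every trial node temperature `θ`. -/
theorem deviceConductance_le (hsym : ∀ a b, g a b = g b a) (hpsd : ∀ θ, 0 ≤ dirichletForm g θ)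
    (θ : ℝ) :
    deviceConductance g ≤ (selfLeft g - bypass g) * (1 / 2 - θ) ^ 2 +
      (selfRight g - bypass g) * (1 / 2 + θ) ^ 2 + bypass g := by
  have hu : selfLeft g - bypass g = transferLeft g := by unfold selfLeft bypass transferLeft; ring
  have hv : selfRight g - bypass g = transferRight g := by
    unfold selfRight bypass transferRight; ring
  rw [hu, hv]
  unfold deviceConductance sideOne floatTemp
  rcases (transfer_sum_nonneg hsym hpsd).eq_or_lt with h0 | hpos
  · have hu0 : transferLeft g = 0 := transferLeft_eq_zero hsym hpsd h0.symm
    have hv0 : transferRight g = 0 := by linarith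
    simp [hu0, hv0]
  · have hne : transferLeft g + transferRight g ≠ 0 := ne_of_gt hpos
    have key : transferLeft g * (1 / 2 - θ) ^ 2 + transferRight g * (1 / 2 + θ) ^ 2 + bypass g -
        (bypass g + transferLeft g *
          (1 / 2 - (transferLeft g - transferRight g) / (2 * (transferLeft g + transferRight g)))) =
        (transferLeft g * (1 / 2 - θ) - transferRight g * (1 / 2 + θ)) ^ 2 /
          (transferLeft g + transferRight g) := by
      field_simp
      ring
    have hnn : 0 ≤ (transferLeft g * (1 / 2 - θ) - transferRight g * (1 / 2 + θ)) ^ 2 /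
        (transferLeft g + transferRight g) := div_nonneg (sq_nonneg _) hpos.le
    linarith

/-- Both ends see the same current when the pair floats: `𝒢₄(θᶠ) = 𝒢₁(θᶠ) = G_dev`. -/
theorem sideFour_floatTemp (hsym : ∀ a b, g a b = g b a) (hpsd : ∀ θ, 0 ≤ dirichletForm g θ) :
    sideFour g (floatTemp g) = deviceConductance g := by
  unfold deviceConductance sideOne sideFour floatTemp
  rcases (transfer_sum_nonneg hsym hpsd).eq_or_lt with h0 | hpos
  · have hu0 : transferLeft g = 0 := transferLeft_eq_zero hsym hpsd h0.symm
    have hv0 : transferRight g = 0 := by linarith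
    simp [hu0, hv0]
  · have hne : transferLeft g + transferRight g ≠ 0 := ne_of_gt hpos
    field_simp
    ring

end OnsagerAlgebra



-- `junctionOU T N M f x = thermo (N + M) (N - 1) T f x + thermo (N + M) N T f x` (`S_K`): likewise
-- declared verbatim by the imported `…ThermoIBP.lean`.

/-- `Π_K f`: average of `f` over the two junction momenta redrawn from the Maxwellian `N(0, T)`
(the conditional expectation given everything but `p_{N−1}, p_N` under the Gibbs state, whose
momenta are i.i.d. `N(0,T)` and independent of the positions). -/
def condK (T : ℝ) (N M : ℕ) (f : PhaseSpace (N + M) → ℝ) (x : PhaseSpace (N + M)) : ℝ :=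
  ∫ ξ : Fin (N + M) → ℝ, f (x.1, fun i => if i.val = N - 1 ∨ i.val = N then ξ i else x.2 i)
    ∂(Measure.pi fun _ : Fin (N + M) => gaussianReal 0 (Real.toNNReal T))

/-- `v_K(f) = ‖(I − Π_K) f‖²_{L²(μ_T)} = E Var(f | everything but p_{N−1}, p_N)`: the JUNCTION
ROUGHNESS of `f` (an oscillation quantity: no derivative of `f` is taken). -/
def roughness (T : ℝ) (N M : ℕ) (f : PhaseSpace (N + M) → ℝ) : ℝ :=
  ∫ x, (f x - condK T N M f x) ^ 2 ∂(P.gibbsMeasure (N + M) T)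

/-- `e_K = (p²_{N−1} + p²_N)/(2T²)`: the local-equilibrium (Gibbs-shift) direction of the pair;
`W₂ + W₃ = −γ S_K e_K` is the identity that makes the floating form of (★) exact. -/
def eK (T : ℝ) (N M : ℕ) (x : PhaseSpace (N + M)) : ℝ :=
  (kin (N + M) (N - 1) x + kin (N + M) N x) / (2 * T ^ 2)

/-- `‖S_K f‖²_{L²(μ_T)}`: the JUNCTION CURVATURE of `f` (two `p`-derivatives, taken only on the
PROBED device's fields, at the `γ`-noised coordinates). -/
def curvature (T : ℝ) (N M : ℕ) (f : PhaseSpace (N + M) → ℝ) : ℝ :=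
  ∫ x, (junctionOU T N M f x) ^ 2 ∂(P.gibbsMeasure (N + M) T)

/-! ## Frames: what the fixed-`N` package hands to the analytic stubs -/

/-- `W = (γ/2T²)(p_0² − p_{L−1}²)`: first-order source of the plain `L`-chain under the bias
`T ± δ/2` (Gaussian integration by parts of `(γ/2)(∂²_{p_0} − ∂²_{p_{L−1}})` against `μ_T`). -/
def plainSource (T : ℝ) (L : ℕ) (x : PhaseSpace L) : ℝ :=
  P.γ / (2 * T ^ 2) * (kin L 0 x - kin L (L - 1) x)

/-- `h` is A first-order NESS density of the plain `L`-chain at `T` w.r.t. the Gibbs state: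
mean zero, `L²(μ_T)`, weak solution of `L_T† h = −W` tested on `C_c^∞`
(`∫ (L_T f) h dμ_T = −∫ f W dμ_T`). -/
def IsPlainResponseField (T : ℝ) (L : ℕ) (h : PhaseSpace L → ℝ) : Prop :=
  MemLp h 2 (P.gibbsMeasure L T) ∧ ∫ x, h x ∂(P.gibbsMeasure L T) = 0 ∧
    ∀ f : PhaseSpace L → ℝ, ContDiff ℝ ∞ f → HasCompactSupport f →
      ∫ x, P.generator L T T f x * h x ∂(P.gibbsMeasure L T) =
        -∫ x, f x * plainSource P T L x ∂(P.gibbsMeasure L T)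

/-- PLAIN FRAME: `h` is THE response field (unique a.e. in its class) and `G` is the two-terminal
conductance it represents through the bath-1 power: `G = γ(1/2 − ⟨p_0² − T, h⟩_{μ_T})`
(in the line `G := D_L/(L−1)` of the crux's own response coefficients). -/
def PlainFrame (T : ℝ) (L : ℕ) (h : PhaseSpace L → ℝ) (G : ℝ) : Prop :=
  IsPlainResponseField P T L h ∧
    (∀ h', IsPlainResponseField P T L h' → h' =ᵐ[P.gibbsMeasure L T] h) ∧
    G = P.γ * (1 / 2 - ∫ x, (kin L 0 x - T) * h x ∂(P.gibbsMeasure L T))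

/-- `gb` is the equilibrium device's FORWARD FIELD of the energy observable of the bath on site
`s`: `gb = (−L_dev)⁻¹ (p_s² − T)` as a classical `C²` solution of `L_dev gb = −(p_s² − T)`, mean
zero, in `L²(μ_T)` together with `S_K gb`. -/
def IsForwardField (T : ℝ) (N M : ℕ) (s : ℕ) (gb : PhaseSpace (N + M) → ℝ) : Prop :=
  ContDiff ℝ 2 gb ∧ MemLp gb 2 (P.gibbsMeasure (N + M) T) ∧
    MemLp (junctionOU T N M gb) 2 (P.gibbsMeasure (N + M) T) ∧
    ∫ x, gb x ∂(P.gibbsMeasure (N + M) T) = 0 ∧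
    ∀ x, deviceGenerator P N M (fun _ => T) gb x = -(kin (N + M) s x - T)

/-- DEVICE FRAME for the split `(N, M)` at temperature `T`: (i) weak steady states of the device
exist and are unique for positive terminal temperatures; (ii) `g` is the symmetric (Onsager)
matrix of transfer conductances, with non-negative entropy-production form, and it IS the
linear response of the four bath powers `γ(τ_a − ⟨p_a²⟩)` at equilibrium along every direction
`θ`; (iii) `gb₁, gb₄` are the (unique) forward fields of the two END baths and the row-`1` /
row-`4` conductances are given by their Kubo formulas
`g_{1b} = (γ²/T²)⟨gb₁, p_b² − T⟩` (`b ≠ 1`), `L₁₁ = γ − (γ²/T²)⟨gb₁, p_0² − T⟩` (and likewise at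
bath 4). Terminals `0,1,2,3` ↦ sites `0, N−1, N, N+M−1`. -/
def DeviceFrame (T : ℝ) (N M : ℕ) (g : Fin 4 → Fin 4 → ℝ)
    (gb₁ gb₄ : PhaseSpace (N + M) → ℝ) : Prop :=
  (∀ τ : Fin 4 → ℝ, (∀ a, 0 < τ a) → ∃ μ, IsDeviceSteadyState P N M τ μ) ∧
  (∀ τ : Fin 4 → ℝ, (∀ a, 0 < τ a) → ∀ μ μ' : Measure (PhaseSpace (N + M)),
      IsDeviceSteadyState P N M τ μ → IsDeviceSteadyState P N M τ μ' → μ = μ') ∧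
  (∀ a b, g a b = g b a) ∧
  (∀ θ, 0 ≤ dirichletForm g θ) ∧
  (∀ (θ : Fin 4 → ℝ) (ν : ℝ → Measure (PhaseSpace (N + M))),
      (∀ ε : ℝ, (∀ a, 0 < T + ε * θ a) →
        IsDeviceSteadyState P N M (fun a => T + ε * θ a) (ν ε)) →
      ∀ a : Fin 4, Tendsto (fun ε : ℝ =>
          P.γ * ((T + ε * θ a) - ∫ x, kin (N + M) (termSite N M a) x ∂(ν ε)) / ε)
        (𝓝[≠] 0) (𝓝 (∑ b, g a b * (θ a - θ b)))) ∧
  IsForwardField P T N M 0 gb₁ ∧ (∀ gb, IsForwardField P T N M 0 gb → gb = gb₁) ∧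
  IsForwardField P T N M (N + M - 1) gb₄ ∧
    (∀ gb, IsForwardField P T N M (N + M - 1) gb → gb = gb₄) ∧
  (∀ b : Fin 4, b ≠ 0 → g 0 b = P.γ ^ 2 / T ^ 2 *
      ∫ x, gb₁ x * (kin (N + M) (termSite N M b) x - T) ∂(P.gibbsMeasure (N + M) T)) ∧
  selfLeft g = P.γ - P.γ ^ 2 / T ^ 2 *
      ∫ x, gb₁ x * (kin (N + M) 0 x - T) ∂(P.gibbsMeasure (N + M) T) ∧
  (∀ b : Fin 4, b ≠ 3 → g 3 b = P.γ ^ 2 / T ^ 2 *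
      ∫ x, gb₄ x * (kin (N + M) (termSite N M b) x - T) ∂(P.gibbsMeasure (N + M) T)) ∧
  selfRight g = P.γ - P.γ ^ 2 / T ^ 2 *
      ∫ x, gb₄ x * (kin (N + M) (N + M - 1) x - T) ∂(P.gibbsMeasure (N + M) T)

/-- CRUX FRAME: the hypotheses of `SuperadditiveResistance` on `(ω₂, lam, β, γ, μ, T, D)`
bundled — parameters positive, weak-NESS uniqueness, `μ` a steady-state family, `T > 0`, `D` its
response coefficients with `D_N > 0` for `N ≥ 2`. -/
def CruxFrame (ω₂ lam β γ : ℝ) (μ : (N : ℕ) → ℝ → ℝ → Measure (PhaseSpace N)) (T : ℝ)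
    (D : ℕ → ℝ) : Prop :=
  0 < ω₂ ∧ 0 < lam ∧ 0 < β ∧ 0 < γ ∧
  (∀ (N : ℕ) (T_L T_R : ℝ), 0 < T_L → 0 < T_R → ∀ μ' ν : Measure (PhaseSpace N),
      (pinnedChain ω₂ lam β γ).IsSteadyState N T_L T_R μ' →
      (pinnedChain ω₂ lam β γ).IsSteadyState N T_L T_R ν → μ' = ν) ∧
  (∀ (N : ℕ) (T_L T_R : ℝ), 0 < T_L → 0 < T_R →
      (pinnedChain ω₂ lam β γ).IsSteadyState N T_L T_R (μ N T_L T_R)) ∧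
  0 < T ∧
  (∀ N : ℕ, Tendsto (fun δ : ℝ =>
      (pinnedChain ω₂ lam β γ).totalCurrent (μ N (T + δ / 2) (T - δ / 2)) / δ)
      (𝓝[≠] 0) (𝓝 (D N))) ∧
  (∀ N : ℕ, 2 ≤ N → 0 < D N)


/-! ## The stub proved in this file -/

/-- STUB 1 — THE INSERTION IDENTITY, floating form, from both ends (exact at fixed `N`): for every
common first-order probe temperature `θ`, `(𝒢₁(θ) − G)² ≤ γ⁴ ‖S_K gb₁‖² v_K(h − θe_K)` and
`(𝒢₄(θ) − G)² ≤ γ⁴ ‖S_K gb₄‖² v_K(h − θe_K)`. All content is in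
`InsertionToolbox.Assembly.insertion_core` (weak equation paired with the non-compactly-supported
forward fields after mollification and energy cutoffs, `S_K`-symmetry, `S_K ⟂ range Π_K` from the
product structure of `μ_T`, current conservation, Cauchy–Schwarz); here the frames are unfolded. -/
theorem stub_insertionIdentity :
    ∀ (ω₂ lam β γ T : ℝ), 0 < ω₂ → 0 < lam → 0 < β → 0 < γ → 0 < T →
      ∀ (N M : ℕ), 2 ≤ N → 2 ≤ M →
      ∀ (h : PhaseSpace (N + M) → ℝ) (G : ℝ) (g : Fin 4 → Fin 4 → ℝ)
        (gb₁ gb₄ : PhaseSpace (N + M) → ℝ),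
        PlainFrame (pinnedChain ω₂ lam β γ) T (N + M) h G →
        DeviceFrame (pinnedChain ω₂ lam β γ) T N M g gb₁ gb₄ →
        ∀ θ : ℝ,
          (sideOne g θ - G) ^ 2 ≤ γ ^ 4 * curvature (pinnedChain ω₂ lam β γ) T N M gb₁ *
              roughness (pinnedChain ω₂ lam β γ) T N M (fun x => h x - θ * eK T N M x) ∧
          (sideFour g θ - G) ^ 2 ≤ γ ^ 4 * curvature (pinnedChain ω₂ lam β γ) T N M gb₄ *
              roughness (pinnedChain ω₂ lam β γ) T N M (fun x => h x - θ * eK T N M x) := by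
  intro ω₂ lam β γ T hω hlam hβ hγ hT N M hN hM h G g gb₁ gb₄ hPF hDF θ
  obtain ⟨⟨hhL2, -, hweak⟩, -, hG⟩ := hPF
  obtain ⟨-, -, hsym, -, -, hgb₁, -, hgb₄, -, hKubo1, hself1, hKubo4, hself4⟩ := hDF
  obtain ⟨h1C2, h1L2, h1SL2, -, h1dev⟩ := hgb₁
  obtain ⟨h4C2, h4L2, h4SL2, -, h4dev⟩ := hgb₄
  exact InsertionToolbox.Assembly.insertion_core hω hlam hβ hγ hT hN hM h G g gb₁ gb₄ θ hhL2 hweak hG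
    hsym h1C2 h1L2 h1SL2 h1dev h4C2 h4L2 h4SL2 h4dev (hKubo1 1 (by decide)) (hKubo1 2 (by decide))
    (hKubo1 3 (by decide)) hself1 (hKubo4 0 (by decide)) (hKubo4 1 (by decide))
    (hKubo4 2 (by decide)) hself4

end Summit.AtomisticToContinuum.FouriersLaw.Cruxes.SuperadditiveResistance.ThermaliseThenCutProbeInsertion

end
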